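import Literature.RepresentationTheory.Kovacevic2021.SU21CohomologyDegreeTwo
import HarnessLib

/-!
# Kovačević's `SU(2,1)`-modules: the Hodge types `(p, q)` of the relative cochains of the six
# cohomological modules (`𝔭 = 𝔭⁺ ⊕ 𝔭⁻`) — Borel–Wallach II 4.2 (3) / VII 4.11 (2) on the constructed modules

Topic `RepresentationTheory/Kovacevic2021`; namespace `Literature.RepresentationTheory.Kovacevic2021`.
Theorems only; no named fact.

For a Hermitian symmetric pair the relative cochains are bigraded by `Λ^n 𝔭_ℂ = ⊕_{p+q=n} Λ^p 𝔭⁺ ⊗ Λ^q 𝔭⁻`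
[BorelWallach2000, II 4.2 (3), 4.5: `H^n(𝔤, K; H) = ⊕_{p+q=n} Hom_K(Λ^p 𝔭⁺ ⊗ Λ^q 𝔭⁻, H)` for unitary `H` with
`C = 0`], and for `G = SU(n,1)` "`D_i` contributes to `H^{i,n-i}`", `J_{ij}` to the types `(i+l, j+l)`
[BorelWallach2000, VI 4.10 (1)–(3), VII 4.11 (2)].  The tree's Chevalley–Eilenberg complex is not bigraded
(`BorelWallach2000.RelativeCohomologyCasimirCriterion`, "NOT here"), but for the complex `𝔤𝔩₃`-modules of a
`K`-type datum `𝒟 : SU21Datum` [Kovacevic2021, §3] the splitting `𝔭 = 𝔭⁺ ⊕ 𝔭⁻ = ⟨E₀₂, E₁₂⟩ ⊕ ⟨E₂₀, E₂₁⟩` is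
explicit, and a relative cochain is determined by its values on tuples of these four basis vectors
(`SU21RelativeCochainsDegreeOne/Two/Three`).  We say a relative `n`-cochain has **type `(p,q)`** if it vanishes on
every basis tuple not consisting of `p` vectors from `𝔭⁺` and `q` from `𝔭⁻`.  This file reads the types off the
`K`-type set `S` of the datum:

* any datum (`§1`): a relative `1`-cochain vanishes on `𝔭⁻` if `V_{2,-3} ∉ S` and on `𝔭⁺` if `V_{2,3} ∉ S`
  (`one_apply_pMinus_eq_zero`, `one_apply_pPlus_eq_zero`, with the coordinate forms `one_apply_of_not_mem_*`);
  a relative `2`-cochain has no `(2,0)`-component if `V_{1,6} ∉ S`, no `(0,2)`-component if `V_{1,-6} ∉ S`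
  (`two_apply_E02_E12_eq_zero`, `two_apply_E20_E21_eq_zero`), no `F_{1,1}`-component if `V_{3,0} ∉ S`
  (`two_apply_F11_eq_zero`: `f(E₀₂,E₂₁) = f(E₁₂,E₂₀) = 0`, `f(E₀₂,E₂₀) = f(E₁₂,E₂₁)`) and no `(1,1)`-component at
  all if moreover `V_{1,0} ∉ S` (`two_apply_mixed_eq_zero`); a relative `3`-cochain has no `(1,2)`-component if
  `V_{2,-3} ∉ S` and no `(2,1)`-component if `V_{2,3} ∉ S` (`three_apply_type12_eq_zero`, `three_apply_type21_eq_zero`);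
* the six modules (`§2`): **`J_{1,0} = Z(3)`: `C¹` of type `(1,0)`, `C³` of type `(2,1)`**; **`J_{0,1} = Z(-3)`:
  types `(0,1)` and `(1,2)`**; **`D₂ = holDS`: `C²` of type `(2,0)`** (`f(y,z) = (y₀₂z₁₂ - y₁₂z₀₂) f(E₀₂,E₁₂)`);
  **`D₀ = antiholDS`: type `(0,2)`**; **`D₁ = midDS`: type `(1,1)` and primitive** (`L`-component zero);
  **`J_{0,0} = U(0)`: `C²` is spanned by the Kähler form** `L = E₀₂^* ∧ E₂₀^* + E₁₂^* ∧ E₂₁^*`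
  (`trivialMod_two_apply`: `f(y,z) = ((y₀₂z₂₀ - y₂₀z₀₂) + (y₁₂z₂₁ - y₂₁z₁₂)) f(E₀₂,E₂₀)`).
  Since all relative cochains of the six modules are closed and `H^q = C^q` (`SU21CohomologyDegreeOne/Two`), these
  are the Hodge types of `H¹(J_{1,0}) = H^{1,0}`, `H³(J_{1,0}) = H^{2,1}`, `H²(D₂) = H^{2,0}`, `H²(D₁) = H^{1,1}_prim`,
  `H²(D₀) = H^{0,2}`, `H^{2l}(J_{0,0}) = ℂ L^l` — [BorelWallach2000, VII 4.11 (2)] at `n = 2` for the constructed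
  modules (which of `𝔭^±` is "holomorphic" is a convention, cf. `SU21ModulesFromKTypes`).

## References

* A. Borel, N. Wallach (2000), II 4.2 (3), 4.5 p. 40; VI 4.8 (4)–(5), Lemma 4.9 (1), 4.10 (1)–(3), Thm 4.11,
  pp. 131–133; VII 4.11 (2) (held chunks p0065, p0166–p0169, p0196). [BorelWallach2000]
* D. Kovačević, Acta Math. Spalatensia 1 (2021) 105–125, §3 Def 1, §4 Thm 5. [Kovacevic2021]
-/

noncomputable section

open Finsupp Module
open Literature.Algebra.Lie Literature.Algebra.Lie.ChevalleyEilenberg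

namespace Literature.RepresentationTheory.Kovacevic2021

-- Mathlib idiom (Mathlib/Algebra/Lie/OfAssociative.lean): bracket on `Matrix`/`Module.End` = commutator.
attribute [local instance 100] LieRing.ofAssociativeRing

namespace SU21Datum

variable {𝒟 : SU21Datum}

/-! ## §1 Support lemmas for an arbitrary `K`-type datum -/

/-- A `𝔨`-highest-weight vector of a type `(n,m)` that is not a `K`-type of the datum is zero.
[cite: Kovacevic2021, §3 Def 1] -/
theorem eq_zero_of_mem_hwSpace_of_not_mem {n m : ℤ} (h : (n, m) ∉ 𝒟.S) {w : 𝒟.V} (hw : w ∈ 𝒟.hwSpace n m) :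
    w = 0 := by
  rwa [hwSpace_eq_span, vec_of_not_mem 1 h, Submodule.span_zero_singleton, Submodule.mem_bot] at hw

/-- `Y_α` kills the highest-weight vectors of the one-dimensional `K`-types `V_{1,m}`. [cite: Kovacevic2021, §3 Def 1] -/
theorem Ya_eq_zero_of_mem_hwSpace_one {m : ℤ} {w : 𝒟.V} (hw : w ∈ 𝒟.hwSpace 1 m) : 𝒟.Ya w = 0 := by
  rw [hwSpace_eq_span, Submodule.mem_span_singleton] at hw
  obtain ⟨c, rfl⟩ := hw
  rw [map_smul, Ya_vec 1 m le_rfl, vec_of_not_range (𝒟 := 𝒟) m (show (1 : ℤ) + 1 < 1 ∨ (1 : ℤ) < 1 + 1 by omega),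
    neg_zero, smul_zero]

/-! ### Degree `1`: `C¹ = Hom_𝔨(𝔭⁺, V) ⊕ Hom_𝔨(𝔭⁻, V)` -/

section DegreeOne

variable {f : Cochain ℂ gl3 𝒟.V 1}

/-- updating the single slot [folklore] -/
private theorem upd1 (w y : gl3) : Function.update ![w] 0 y = ![y] := by
  funext i
  fin_cases i
  rfl

/-- `f(-y) = -f(y)` for a `1`-cochain [folklore] -/
private theorem one_neg (f : Cochain ℂ gl3 𝒟.V 1) (y : gl3) : f ![-y] = -f ![y] := by
  have h := f.map_update_neg ![y] 0 y
  rwa [upd1, upd1] at h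

/-- `f(E₁₂) = Y_α f(E₀₂)` and `f(E₂₀) = -Y_α f(E₂₁)` for a relative `1`-cochain (`E₁₂ = ⁅E₁₀, E₀₂⁆`,
`E₂₀ = -⁅E₁₀, E₂₁⁆`). [cite: Kovacevic2021, §3 Def 1] [cite: BorelWallach2000, I §1.2 (1)] -/
theorem one_apply_E12_E20 (hf : f ∈ 𝒟.relCochain 1) :
    f ![E 1 2] = 𝒟.Ya (f ![E 0 2]) ∧ f ![E 2 0] = -𝒟.Ya (f ![E 2 1]) := by
  obtain ⟨h1, -⟩ := (𝒟.mem_relCochain_one_iff f).1 hf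
  refine ⟨?_, ?_⟩
  · rw [← lie_E10.1, ← h1 _ (E_mem_kSub 1 0 (by decide)), lie_def, ρfun_E]
  · rw [← neg_neg (E 2 0), ← lie_E10.2, one_neg, ← h1 _ (E_mem_kSub 1 0 (by decide)), lie_def, ρfun_E]

/-- **No `V_{2,-3}` ⇒ relative `1`-cochains vanish on `𝔭⁻`** (type `(1,0)`). [cite: BorelWallach2000, VI 4.8 (5), II 4.2 (3)] -/
theorem one_apply_pMinus_eq_zero (h : ((2 : ℤ), (-3 : ℤ)) ∉ 𝒟.S) (hf : f ∈ 𝒟.relCochain 1) :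
    f ![E 2 0] = 0 ∧ f ![E 2 1] = 0 := by
  have h21 : f ![E 2 1] = 0 := eq_zero_of_mem_hwSpace_of_not_mem h (apply_E21_mem_hwSpace hf)
  exact ⟨by rw [(one_apply_E12_E20 hf).2, h21, map_zero, neg_zero], h21⟩

/-- **No `V_{2,3}` ⇒ relative `1`-cochains vanish on `𝔭⁺`** (type `(0,1)`). [cite: BorelWallach2000, VI 4.8 (5), II 4.2 (3)] -/
theorem one_apply_pPlus_eq_zero (h : ((2 : ℤ), (3 : ℤ)) ∉ 𝒟.S) (hf : f ∈ 𝒟.relCochain 1) :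
    f ![E 0 2] = 0 ∧ f ![E 1 2] = 0 := by
  have h02 : f ![E 0 2] = 0 := eq_zero_of_mem_hwSpace_of_not_mem h (apply_E02_mem_hwSpace hf)
  exact ⟨h02, by rw [(one_apply_E12_E20 hf).1, h02, map_zero]⟩

/-- Type `(1,0)` in coordinates: with no `V_{2,-3}`, `f(y) = y₀₂ f(E₀₂) + y₁₂ f(E₁₂)` depends only on the
`𝔭⁺`-part of `y`. [cite: BorelWallach2000, II 4.2 (3)] -/
theorem one_apply_of_not_mem_minus (h : ((2 : ℤ), (-3 : ℤ)) ∉ 𝒟.S) (hf : f ∈ 𝒟.relCochain 1) (y : gl3) :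
    f ![y] = y 0 2 • f ![E 0 2] + y 1 2 • f ![E 1 2] := by
  have e := congrArg (fun φ : Cochain ℂ gl3 𝒟.V 1 => φ ![y]) (eq_pairCochain hf)
  simp only [pairCochain_apply, Matrix.cons_val_zero, pairMap_apply] at e
  rw [e, (one_apply_pMinus_eq_zero h hf).2, (one_apply_E12_E20 hf).1, map_zero, smul_zero, smul_zero, add_zero,
    sub_zero]

/-- Type `(0,1)` in coordinates: with no `V_{2,3}`, `f(y) = y₂₀ f(E₂₀) + y₂₁ f(E₂₁)`. [cite: BorelWallach2000, II 4.2 (3)] -/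
theorem one_apply_of_not_mem_plus (h : ((2 : ℤ), (3 : ℤ)) ∉ 𝒟.S) (hf : f ∈ 𝒟.relCochain 1) (y : gl3) :
    f ![y] = y 2 0 • f ![E 2 0] + y 2 1 • f ![E 2 1] := by
  have e := congrArg (fun φ : Cochain ℂ gl3 𝒟.V 1 => φ ![y]) (eq_pairCochain hf)
  simp only [pairCochain_apply, Matrix.cons_val_zero, pairMap_apply] at e
  rw [e, (one_apply_pPlus_eq_zero h hf).1, (one_apply_E12_E20 hf).2, map_zero, smul_zero, smul_zero, zero_add,
    zero_add, smul_neg, sub_eq_add_neg, add_comm]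

end DegreeOne

/-! ### Degree `2`: `Λ²𝔭 = Λ²𝔭⁺ ⊕ (𝔭⁺ ⊗ 𝔭⁻) ⊕ Λ²𝔭⁻`, `𝔭⁺ ⊗ 𝔭⁻ = F_{1,1} ⊕ ℂL` -/

section DegreeTwo

variable {f : Cochain ℂ gl3 𝒟.V 2}

/-- **No `V_{1,6} = Λ²𝔭⁺` ⇒ no `(2,0)`-component**: `f(E₀₂, E₁₂) = 0`. [cite: BorelWallach2000, VI 4.8 (5), II 4.2 (3)] -/
theorem two_apply_E02_E12_eq_zero (h : ((1 : ℤ), (6 : ℤ)) ∉ 𝒟.S) (hf : f ∈ 𝒟.relCochain 2) :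
    f ![E 0 2, E 1 2] = 0 :=
  eq_zero_of_mem_hwSpace_of_not_mem h (apply_E02_E12_mem_hwSpace hf)

/-- **No `V_{1,-6} = Λ²𝔭⁻` ⇒ no `(0,2)`-component**: `f(E₂₀, E₂₁) = 0`. [cite: BorelWallach2000, VI 4.8 (5), II 4.2 (3)] -/
theorem two_apply_E20_E21_eq_zero (h : ((1 : ℤ), (-6 : ℤ)) ∉ 𝒟.S) (hf : f ∈ 𝒟.relCochain 2) :
    f ![E 2 0, E 2 1] = 0 :=
  eq_zero_of_mem_hwSpace_of_not_mem h (apply_E20_E21_mem_hwSpace hf)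

/-- **No `V_{3,0} = F_{1,1}` ⇒ the `(1,1)`-part is a multiple of the Kähler form `L`**:
`f(E₀₂,E₂₁) = 0`, `f(E₁₂,E₂₀) = 0` and `f(E₀₂,E₂₀) = f(E₁₂,E₂₁)` (the highest-weight vector `E₀₂ ∧ E₂₁` of `F_{1,1}`
and its `Y_α`-translates pair to zero). [cite: BorelWallach2000, VI 4.8 (4), Lemma 4.9 (1)] -/
theorem two_apply_F11_eq_zero (h : ((3 : ℤ), (0 : ℤ)) ∉ 𝒟.S) (hf : f ∈ 𝒟.relCochain 2) :
    f ![E 0 2, E 2 1] = 0 ∧ f ![E 1 2, E 2 0] = 0 ∧ f ![E 0 2, E 2 0] = f ![E 1 2, E 2 1] := by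
  have h21 : f ![E 0 2, E 2 1] = 0 := eq_zero_of_mem_hwSpace_of_not_mem h (apply_E02_E21_mem_hwSpace hf)
  obtain ⟨d1, d2⟩ := apply_descent hf
  rw [h21, map_zero, sub_eq_zero] at d1
  -- `f(E₁₂,E₂₁) = f(E₀₂,E₂₀)` lies on the `hw(1,0)`-line (`-2 f(E₁₂,E₂₁) = L`-value), so `Y_α` kills it
  have hL := apply_L_mem_hwSpace hf
  rw [← d1, show -f ![E 1 2, E 2 1] - f ![E 1 2, E 2 1] = (-2 : ℂ) • f ![E 1 2, E 2 1] by module] at hL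
  have h1221 : f ![E 1 2, E 2 1] ∈ 𝒟.hwSpace 1 0 := by
    have := Submodule.smul_mem _ (-(1 / 2 : ℂ)) hL
    rwa [smul_smul, show (-(1 / 2 : ℂ)) * (-2 : ℂ) = 1 by norm_num, one_smul] at this
  refine ⟨h21, ?_, d1.symm⟩
  rw [d2, Ya_eq_zero_of_mem_hwSpace_one h1221, neg_zero]

/-- **No `V_{3,0}` and no `V_{1,0}` ⇒ no `(1,1)`-component at all**: all four mixed pair values vanish.
[cite: BorelWallach2000, VI 4.8 (4)–(5), Lemma 4.9 (1), II 4.2 (3)] -/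
theorem two_apply_mixed_eq_zero (h30 : ((3 : ℤ), (0 : ℤ)) ∉ 𝒟.S) (h10 : ((1 : ℤ), (0 : ℤ)) ∉ 𝒟.S)
    (hf : f ∈ 𝒟.relCochain 2) :
    f ![E 0 2, E 2 0] = 0 ∧ f ![E 0 2, E 2 1] = 0 ∧ f ![E 1 2, E 2 0] = 0 ∧ f ![E 1 2, E 2 1] = 0 := by
  obtain ⟨h21, h1220, hdiag⟩ := two_apply_F11_eq_zero h30 hf
  have hL : -f ![E 0 2, E 2 0] - f ![E 1 2, E 2 1] = 0 :=
    eq_zero_of_mem_hwSpace_of_not_mem h10 (apply_L_mem_hwSpace hf)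
  rw [hdiag, show -f ![E 1 2, E 2 1] - f ![E 1 2, E 2 1] = (-2 : ℂ) • f ![E 1 2, E 2 1] by module,
    smul_eq_zero] at hL
  have h1221 : f ![E 1 2, E 2 1] = 0 := hL.resolve_left (by norm_num)
  exact ⟨hdiag.trans h1221, h21, h1220, h1221⟩

/-- **Type `(2,0)` in coordinates**: with no `V_{3,0}, V_{1,0}, V_{1,-6}`, `f(y,z) = (y₀₂ z₁₂ - y₁₂ z₀₂) f(E₀₂,E₁₂)` —
`f` is a multiple of `E₀₂^* ∧ E₁₂^*`, the dual of `Λ²𝔭⁺`. [cite: BorelWallach2000, VI 4.10 (1)–(3), II 4.2 (3)] -/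
theorem two_apply_of_type20 (h30 : ((3 : ℤ), (0 : ℤ)) ∉ 𝒟.S) (h10 : ((1 : ℤ), (0 : ℤ)) ∉ 𝒟.S)
    (h06 : ((1 : ℤ), (-6 : ℤ)) ∉ 𝒟.S) (hf : f ∈ 𝒟.relCochain 2) (y z : gl3) :
    f ![y, z] = (y 0 2 * z 1 2 - y 1 2 * z 0 2) • f ![E 0 2, E 1 2] := by
  obtain ⟨a, b, c, e⟩ := two_apply_mixed_eq_zero h30 h10 hf
  rw [two_expand hf y z, a, b, c, e, two_apply_E20_E21_eq_zero h06 hf]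
  simp only [smul_zero, add_zero]

/-- **Type `(0,2)` in coordinates**: with no `V_{3,0}, V_{1,0}, V_{1,6}`, `f(y,z) = (y₂₀ z₂₁ - y₂₁ z₂₀) f(E₂₀,E₂₁)`.
[cite: BorelWallach2000, VI 4.10 (1)–(3), II 4.2 (3)] -/
theorem two_apply_of_type02 (h30 : ((3 : ℤ), (0 : ℤ)) ∉ 𝒟.S) (h10 : ((1 : ℤ), (0 : ℤ)) ∉ 𝒟.S)
    (h60 : ((1 : ℤ), (6 : ℤ)) ∉ 𝒟.S) (hf : f ∈ 𝒟.relCochain 2) (y z : gl3) :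
    f ![y, z] = (y 2 0 * z 2 1 - y 2 1 * z 2 0) • f ![E 2 0, E 2 1] := by
  obtain ⟨a, b, c, e⟩ := two_apply_mixed_eq_zero h30 h10 hf
  rw [two_expand hf y z, a, b, c, e, two_apply_E02_E12_eq_zero h60 hf]
  simp only [smul_zero, add_zero, zero_add]

/-- **The Kähler line in coordinates**: with no `V_{1,6}, V_{3,0}, V_{1,-6}`,
`f(y,z) = ((y₀₂ z₂₀ - y₂₀ z₀₂) + (y₁₂ z₂₁ - y₂₁ z₁₂)) f(E₀₂,E₂₀)` — `f` is a multiple of the Kähler form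
`L = E₀₂^* ∧ E₂₀^* + E₁₂^* ∧ E₂₁^*` of `𝔭`. [cite: BorelWallach2000, VI 4.8 (4), Lemma 4.9 (1)] -/
theorem two_apply_of_typeL (h60 : ((1 : ℤ), (6 : ℤ)) ∉ 𝒟.S) (h30 : ((3 : ℤ), (0 : ℤ)) ∉ 𝒟.S)
    (h06 : ((1 : ℤ), (-6 : ℤ)) ∉ 𝒟.S) (hf : f ∈ 𝒟.relCochain 2) (y z : gl3) :
    f ![y, z] = ((y 0 2 * z 2 0 - y 2 0 * z 0 2) + (y 1 2 * z 2 1 - y 2 1 * z 1 2)) • f ![E 0 2, E 2 0] := by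
  obtain ⟨h21, h1220, hdiag⟩ := two_apply_F11_eq_zero h30 hf
  rw [two_expand hf y z, h21, h1220, ← hdiag, two_apply_E02_E12_eq_zero h60 hf, two_apply_E20_E21_eq_zero h06 hf]
  simp only [smul_zero, add_zero, zero_add]
  rw [add_smul]

end DegreeTwo

/-! ### Degree `3`: `Λ³𝔭 = Λ²𝔭⁺ ⊗ 𝔭⁻ ⊕ 𝔭⁺ ⊗ Λ²𝔭⁻ = F_{1,0} ⊕ F_{0,1}` -/

section DegreeThree

variable {f : Cochain ℂ gl3 𝒟.V 3}

/-- **No `V_{2,-3}` ⇒ no `(1,2)`-component**: a relative `3`-cochain vanishes on the basis triples with two entries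
from `𝔭⁻`, `f(E₀₂,E₂₀,E₂₁) = f(E₁₂,E₂₀,E₂₁) = 0` (type `(2,1)`).
[cite: BorelWallach2000, VI 4.8 (5), Lemma 4.9, II 4.2 (3)] -/
theorem three_apply_type12_eq_zero (h : ((2 : ℤ), (-3 : ℤ)) ∉ 𝒟.S) (hf : f ∈ 𝒟.relCochain 3) :
    f ![E 0 2, E 2 0, E 2 1] = 0 ∧ f ![E 1 2, E 2 0, E 2 1] = 0 := by
  have h1 : f ![E 0 2, E 2 0, E 2 1] = 0 := eq_zero_of_mem_hwSpace_of_not_mem h (apply_T1_mem_hwSpace hf)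
  exact ⟨h1, by rw [(three_descent hf).2, h1, map_zero]⟩

/-- **No `V_{2,3}` ⇒ no `(2,1)`-component**: `f(E₀₂,E₁₂,E₂₁) = f(E₀₂,E₁₂,E₂₀) = 0` (type `(1,2)`).
[cite: BorelWallach2000, VI 4.8 (5), Lemma 4.9, II 4.2 (3)] -/
theorem three_apply_type21_eq_zero (h : ((2 : ℤ), (3 : ℤ)) ∉ 𝒟.S) (hf : f ∈ 𝒟.relCochain 3) :
    f ![E 0 2, E 1 2, E 2 1] = 0 ∧ f ![E 0 2, E 1 2, E 2 0] = 0 := by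
  have h1 : f ![E 0 2, E 1 2, E 2 1] = 0 := eq_zero_of_mem_hwSpace_of_not_mem h (apply_T2_mem_hwSpace hf)
  exact ⟨h1, by rw [(three_descent hf).1, h1, map_zero, neg_zero]⟩

end DegreeThree

/-! ## §2 The six cohomological modules -/

section Six

/-- **`J_{1,0} = Z(3)` (`ladderPlus`): `H¹` has type `(1,0)` and `H³` has type `(2,1)`** — relative `1`-cochains
vanish on `𝔭⁻`, relative `3`-cochains on the triples with two `𝔭⁻`-entries (`H^q(J_{1,0}) = C^q`, `q = 1, 3`).
[cite: BorelWallach2000, VI Thm 4.11 (3), VII 4.11 (2)] -/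
theorem ladderPlus_hodgeTypes :
    (∀ f ∈ ladderPlus.relCochain 1, f ![E 2 0] = 0 ∧ f ![E 2 1] = 0) ∧
    (∀ f ∈ ladderPlus.relCochain 1, ∀ y : gl3, f ![y] = y 0 2 • f ![E 0 2] + y 1 2 • f ![E 1 2]) ∧
    (∀ f ∈ ladderPlus.relCochain 3, f ![E 0 2, E 2 0, E 2 1] = 0 ∧ f ![E 1 2, E 2 0, E 2 1] = 0) :=
  ⟨fun _ hf => one_apply_pMinus_eq_zero six_Ktypes.2.2.2.2.1.2.2 hf,
    fun _ hf y => one_apply_of_not_mem_minus six_Ktypes.2.2.2.2.1.2.2 hf y,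
    fun _ hf => three_apply_type12_eq_zero six_Ktypes.2.2.2.2.1.2.2 hf⟩

/-- **`J_{0,1} = Z(-3)` (`ladderMinus`): `H¹` has type `(0,1)` and `H³` has type `(1,2)`.**
[cite: BorelWallach2000, VI Thm 4.11 (3), VII 4.11 (2)] -/
theorem ladderMinus_hodgeTypes :
    (∀ f ∈ ladderMinus.relCochain 1, f ![E 0 2] = 0 ∧ f ![E 1 2] = 0) ∧
    (∀ f ∈ ladderMinus.relCochain 1, ∀ y : gl3, f ![y] = y 2 0 • f ![E 2 0] + y 2 1 • f ![E 2 1]) ∧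
    (∀ f ∈ ladderMinus.relCochain 3, f ![E 0 2, E 1 2, E 2 1] = 0 ∧ f ![E 0 2, E 1 2, E 2 0] = 0) :=
  ⟨fun _ hf => one_apply_pPlus_eq_zero six_Ktypes.2.2.2.2.2.2.1 hf,
    fun _ hf y => one_apply_of_not_mem_plus six_Ktypes.2.2.2.2.2.2.1 hf y,
    fun _ hf => three_apply_type21_eq_zero six_Ktypes.2.2.2.2.2.2.1 hf⟩

/-- **`D₂` (`holDS`, lowest `K`-type `F_{2,0} = Λ²𝔭⁺`): `H² = C²` has type `(2,0)`** — every relative `2`-cochain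
is `f(E₀₂,E₁₂) · E₀₂^* ∧ E₁₂^*`. [cite: BorelWallach2000, VI 4.10 (3), VII 4.11 (2)] -/
theorem holDS_hodgeType (f : Cochain ℂ gl3 holDS.V 2) (hf : f ∈ holDS.relCochain 2) (y z : gl3) :
    f ![y, z] = (y 0 2 * z 1 2 - y 1 2 * z 0 2) • f ![E 0 2, E 1 2] :=
  two_apply_of_type20 six_Ktypes₂.2.1.2.1 six_Ktypes.2.1.1 six_Ktypes₂.2.1.2.2 hf y z

/-- **`D₀` (`antiholDS`, lowest `K`-type `F_{0,2} = Λ²𝔭⁻`): `H² = C²` has type `(0,2)`** —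
`f = f(E₂₀,E₂₁) · E₂₀^* ∧ E₂₁^*`. [cite: BorelWallach2000, VI 4.10 (3), VII 4.11 (2)] -/
theorem antiholDS_hodgeType (f : Cochain ℂ gl3 antiholDS.V 2) (hf : f ∈ antiholDS.relCochain 2) (y z : gl3) :
    f ![y, z] = (y 2 0 * z 2 1 - y 2 1 * z 2 0) • f ![E 2 0, E 2 1] :=
  two_apply_of_type02 six_Ktypes₂.2.2.1.2.1 six_Ktypes.2.2.1.1 six_Ktypes₂.2.2.1.1 hf y z

/-- **`D₁` (`midDS`, lowest `K`-type `F_{1,1}`): `H² = C²` has type `(1,1)` and is primitive** — no `(2,0)` or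
`(0,2)` component and zero `L`-component: `f(E₀₂,E₁₂) = f(E₂₀,E₂₁) = 0`, `f(E₀₂,E₂₀) + f(E₁₂,E₂₁) = 0`.
[cite: BorelWallach2000, VI 4.10 (3), Lemma 4.9 (1), VII 4.11 (2)] -/
theorem midDS_hodgeType (f : Cochain ℂ gl3 midDS.V 2) (hf : f ∈ midDS.relCochain 2) :
    f ![E 0 2, E 1 2] = 0 ∧ f ![E 2 0, E 2 1] = 0 ∧ f ![E 0 2, E 2 0] + f ![E 1 2, E 2 1] = 0 := by
  refine ⟨two_apply_E02_E12_eq_zero six_Ktypes₂.2.2.2.1.1 hf, two_apply_E20_E21_eq_zero six_Ktypes₂.2.2.2.1.2.2 hf,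
    ?_⟩
  have hL : -f ![E 0 2, E 2 0] - f ![E 1 2, E 2 1] = 0 :=
    eq_zero_of_mem_hwSpace_of_not_mem six_Ktypes.2.2.2.1.1 (apply_L_mem_hwSpace hf)
  rw [← neg_eq_zero, neg_add', ← hL]

/-- **`J_{0,0} = U(0)` (`trivialMod`): `H² = C²` is the Kähler line `ℂ L`** (type `(1,1)`):
`f(y,z) = ((y₀₂ z₂₀ - y₂₀ z₀₂) + (y₁₂ z₂₁ - y₂₁ z₁₂)) f(E₀₂,E₂₀)`. [cite: BorelWallach2000, VI 4.8 (4), Thm 4.11 (3)] -/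
theorem trivialMod_two_apply (f : Cochain ℂ gl3 trivialMod.V 2) (hf : f ∈ trivialMod.relCochain 2) (y z : gl3) :
    f ![y, z] = ((y 0 2 * z 2 0 - y 2 0 * z 0 2) + (y 1 2 * z 2 1 - y 2 1 * z 1 2)) • f ![E 0 2, E 2 0] :=
  two_apply_of_typeL six_Ktypes₂.1.1 six_Ktypes₂.1.2.1 six_Ktypes₂.1.2.2 hf y z

end Six

end SU21Datum

end Literature.RepresentationTheory.Kovacevic2021
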